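import Literature.InformationTheory.QuantumCodes.QuantumExpanderCodes
import Literature.Probability.LatticeModels.LatticeAnimalsTreeCount
import Literature.Combinatorics.BinomialEntropyBound
import Mathlib.Analysis.SpecialFunctions.BinaryEntropy
import Mathlib.Analysis.Convex.Deriv
import Mathlib.Combinatorics.Enumerative.DoubleCounting
import Mathlib.Algebra.Order.Field.GeomSum
import HarnessLib

/-!
# `α`-percolation with the printed constants: Fawzi–Grospellier–Leverrier 2018, Theorem 17 — PROOF

Index of sources: `[cite: FawziGrospellierLeverrier2018]` = Fawzi–Grospellier–Leverrier, "Efficient decoding of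
random errors for quantum expander codes", STOC 2018 / arXiv:1711.08351v2: Thm 17 (§4, p0013 L7-24) and its proof
(p0013 L38-75), Lemma 25 / Lemma 27 / Cor 28 (§7.2, p0019).

qec PARTITION v2 row 04 (`prover-qec-type-04`, gen 4), item 04.FGL17: DISCHARGE of the named fact
`FGL18_theorem17` (`QuantumExpanderCodes.lean`) — the `α`-percolation bound for locally stochastic errors on a
graph of degree `≤ d` (`d ≥ 3`) with the SHARP printed constants
`p_ls = (2^{-h(α)}/K(d))^{1/α}`, `K(d) = (d-1)(1+1/(d-2))^{d-2}`, `1/C = (1 - 2^{h(α)/α}p)(1 - (p/p_ls)^α)`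
(the tree's `AlphaClusterCountingBound` has the same shape with the cruder Peierls constant `2Δ²`). The printed
proof, step by step:

* `card_connectedOfCard_le_mul_choose` — **Cor 28, middle line**: `|𝒞_s(𝒢)| ≤ |V|·C((d-1)s, s)`, from the
  exploration count `|𝒞_s(v)| ≤ C((d-1)s+1, s-1)` of `LatticeAnimalsTreeCount` (`TreeCount.card_le_choose_of_isGraphConnected`,
  replacing the labelled-tree count of Lemma 27), the double count `Σ_v |𝒞_s(v)| = s·|𝒞_s(𝒢)|`, and the binomial
  inequality `C((d-1)s+1, s-1) ≤ s·C((d-1)s, s)` (`d ≥ 3`);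
* `choose_le_exp_mul_binEntropy` — **Lemma 25**: `C(n,k) ≤ 2^{n h(k/n)}` (in nats: `≤ exp(n·binEntropy(k/n))`;
  from the tree's van Lint bound `vanLint_sum_choose_le_exp_binEntropy` and `h(1-x) = h(x)`);
* `exp_mul_binEntropy_inv` — the constant: `exp((d-1)·h(1/(d-1))) = (d-1)(1+1/(d-2))^{d-2} = K(d)`, so
  `C((d-1)s, s) ≤ K(d)^s` (**Cor 28, last line**, `choose_le_K_pow`);
* `binEntropy_div_le_div` — "`x ↦ h(x)/x` is non increasing on `[α,1]`" (concavity of `h`, `h(0) = 0`);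
* `sum_filter_alphaDense_le_exp` — for a FIXED `X` of size `s`: `μ{E : |X ∩ E| ≥ α|X|} ≤ C(s,⌈αs⌉)p^{⌈αs⌉}
  ≤ (2^{h(α)/α}p)^{⌈αs⌉} ≤ 2^{h(α)s} p^{αs}` (we take only the subsets of size exactly `⌈αs⌉`, so the printed factor
  `1/(1 - 2^{h(α)/α}p) ≥ 1` is not even needed; the final bound is weakened to the printed constant);
* `FGL18_theorem17_holds : FGL18_theorem17` — the union bound over `s ≥ t` and `X ∈ 𝒞_s(𝒢)` and the geometric sum:
  `≤ |V| Σ_{s≥t} (K 2^{h} p^α)^s = |V| q^t/(1-q)` with `q = (p/p_ls)^α < 1`.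

All statements PROVED (kernel axioms); no definitions, no new named facts. Natural logarithms throughout
(`2^{h₂(α)} = e^{binEntropy α}`), exactly as the fact is typed.
-/

namespace Literature.InformationTheory.QuantumCodes

open Finset Real Literature.Probability.LatticeModels

/-! ### Lemma 25: binomial coefficients and the binary entropy -/

section Binomial

/-- **FGL18 Lemma 25** (nats): `C(n,k) ≤ exp(n·h(k/n))` for `k ≤ n` — the single term of van Lint's tail bound
(`Σ_{i ≤ λn} C(n,i) ≤ exp(n h(λ))`, `λ ≤ 1/2`), with the symmetry `C(n,k) = C(n,n-k)`, `h(1-x) = h(x)` for `k > n/2`.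
[cite: FawziGrospellierLeverrier2018, Lemma 25 (§7.2, arXiv v2 p0019)] -/
theorem choose_le_exp_mul_binEntropy {n k : ℕ} (hkn : k ≤ n) :
    (n.choose k : ℝ) ≤ Real.exp (n * Real.binEntropy ((k : ℝ) / n)) := by
  rcases Nat.eq_zero_or_pos n with rfl | hn
  · have hk : k = 0 := Nat.le_zero.1 hkn
    subst hk
    simp
  have hn' : (0 : ℝ) < n := by exact_mod_cast hn
  -- the half case
  have half : ∀ {m : ℕ}, m ≤ n → 2 * m ≤ n →
      (n.choose m : ℝ) ≤ Real.exp (n * Real.binEntropy ((m : ℝ) / n)) := by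
    intro m hmn h2m
    have hl0 : (0 : ℝ) ≤ (m : ℝ) / n := by positivity
    have hl1 : (m : ℝ) / n ≤ 1 / 2 := by
      rw [div_le_iff₀ hn']
      have : (2 : ℝ) * m ≤ n := by exact_mod_cast h2m
      linarith
    have hvl := Literature.Combinatorics.vanLint_sum_choose_le_exp_binEntropy n hl0 hl1
    have hfloor : ⌊(m : ℝ) / n * n⌋₊ = m := by
      rw [div_mul_cancel₀ _ hn'.ne', Nat.floor_natCast]
    rw [hfloor] at hvl
    refine le_trans ?_ hvl
    have hmem : m ∈ Finset.range (m + 1) := Finset.mem_range.2 (Nat.lt_succ_self m)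
    exact Finset.single_le_sum (f := fun i => (n.choose i : ℝ)) (fun i _ => Nat.cast_nonneg _) hmem
  by_cases h2k : 2 * k ≤ n
  · exact half hkn h2k
  · -- the symmetric case `k > n/2`
    have h2 : 2 * (n - k) ≤ n := by omega
    have h := half (Nat.sub_le n k) h2
    rw [Nat.choose_symm hkn] at h
    have hx : ((n - k : ℕ) : ℝ) / n = 1 - (k : ℝ) / n := by
      rw [Nat.cast_sub hkn]
      field_simp
    rwa [hx, Real.binEntropy_one_sub] at h

/-- **"`x ↦ h(x)/x` is non increasing"** on `(0,1]`: for `0 < α ≤ x ≤ 1`, `h(x)/x ≤ h(α)/α` (`h` is concave on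
`[0,1]` with `h(0) = 0`, so its secant slopes from `0` decrease). [cite: FawziGrospellierLeverrier2018, Thm 17 proof ("since (x ↦ h(x)/x) is non increasing on [α,1]"; §4, arXiv v2 p0013 L63)] -/
theorem binEntropy_div_le_div {α x : ℝ} (hα : 0 < α) (hαx : α ≤ x) (hx : x ≤ 1) :
    Real.binEntropy x / x ≤ Real.binEntropy α / α := by
  have hconc : ConcaveOn ℝ (Set.Icc (0 : ℝ) 1) Real.binEntropy := Real.strictConcave_binEntropy.concaveOn
  have h0 : (0 : ℝ) ∈ Set.Icc (0 : ℝ) 1 := ⟨le_rfl, zero_le_one⟩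
  have hanti := hconc.slope_anti h0
  have hαmem : α ∈ Set.Icc (0 : ℝ) 1 \ {0} := ⟨⟨hα.le, hαx.trans hx⟩, hα.ne'⟩
  have hxmem : x ∈ Set.Icc (0 : ℝ) 1 \ {0} := ⟨⟨hα.le.trans hαx, hx⟩, (hα.trans_le hαx).ne'⟩
  have h := hanti hαmem hxmem hαx
  simp only [slope_def_field, Real.binEntropy_zero, sub_zero] at h
  exact h

/-- **The constant `K(d)`**: `exp((d-1)·h(1/(d-1))) = (d-1)(1 + 1/(d-2))^{d-2}` for `d ≥ 3`
(`(d-1)h(1/(d-1)) = log(d-1) + (d-2) log((d-1)/(d-2))`). [cite: FawziGrospellierLeverrier2018, Cor 28 proof (last line; §7.2, arXiv v2 p0019)] -/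
theorem exp_mul_binEntropy_inv {d : ℕ} (hd : 3 ≤ d) :
    Real.exp (((d : ℝ) - 1) * Real.binEntropy (1 / ((d : ℝ) - 1)))
      = ((d : ℝ) - 1) * (1 + 1 / ((d : ℝ) - 2)) ^ (d - 2) := by
  have hd' : (3 : ℝ) ≤ d := by exact_mod_cast hd
  set m : ℝ := (d : ℝ) - 1 with hm
  have hm0 : 0 < m := by rw [hm]; linarith
  have hm1 : 0 < m - 1 := by rw [hm]; linarith
  have hcast : ((d - 2 : ℕ) : ℝ) = m - 1 := by
    rw [Nat.cast_sub (by omega : 2 ≤ d)]; rw [hm]; push_cast; ring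
  have hd2 : (d : ℝ) - 2 = m - 1 := by rw [hm]; ring
  -- `m·h(1/m) = log m + (m-1) log(m/(m-1))`
  have hent : m * Real.binEntropy (1 / m) = Real.log m + (m - 1) * Real.log (m / (m - 1)) := by
    unfold Real.binEntropy
    have h1 : (1 / m)⁻¹ = m := by rw [one_div, inv_inv]
    have h2 : (1 - 1 / m) = (m - 1) / m := by field_simp
    have h3 : ((m - 1) / m)⁻¹ = m / (m - 1) := by rw [inv_div]
    rw [h1, h2, h3]
    field_simp
  rw [hent, Real.exp_add, Real.exp_log hm0, hd2]
  congr 1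
  have hratio : m / (m - 1) = 1 + 1 / (m - 1) := by rw [one_add_div hm1.ne', sub_add_cancel]
  nth_rw 1 [← hcast]
  rw [Real.exp_nat_mul, Real.exp_log (div_pos hm0 hm1), hratio]

/-- **Cor 28, last line**: `C((d-1)s, s) ≤ K(d)^s`, `K(d) = (d-1)(1+1/(d-2))^{d-2}` (`d ≥ 3`).
[cite: FawziGrospellierLeverrier2018, Cor 28 (§7.2, arXiv v2 p0019)] -/
theorem choose_le_K_pow {d : ℕ} (hd : 3 ≤ d) (s : ℕ) :
    ((((d - 1) * s).choose s : ℕ) : ℝ) ≤ (((d : ℝ) - 1) * (1 + 1 / ((d : ℝ) - 2)) ^ (d - 2)) ^ s := by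
  rcases Nat.eq_zero_or_pos s with rfl | hs
  · simp
  have hd1 : 1 ≤ d - 1 := by omega
  have hle : s ≤ (d - 1) * s := Nat.le_mul_of_pos_left s (by omega)
  refine (choose_le_exp_mul_binEntropy hle).trans (le_of_eq ?_)
  have hs' : (0 : ℝ) < s := by exact_mod_cast hs
  have hcast : (((d - 1) * s : ℕ) : ℝ) = ((d : ℝ) - 1) * s := by
    rw [Nat.cast_mul, Nat.cast_sub (by omega : 1 ≤ d)]; push_cast; ring
  have hd1' : (0 : ℝ) < (d : ℝ) - 1 := by
    have : (3 : ℝ) ≤ d := by exact_mod_cast hd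
    linarith
  rw [hcast]
  have hx : (s : ℝ) / (((d : ℝ) - 1) * s) = 1 / ((d : ℝ) - 1) := by
    field_simp
  rw [hx, show ((d : ℝ) - 1) * s * Real.binEntropy (1 / ((d : ℝ) - 1))
      = (s : ℕ) * (((d : ℝ) - 1) * Real.binEntropy (1 / ((d : ℝ) - 1))) by ring,
    Real.exp_nat_mul, exp_mul_binEntropy_inv hd]

end Binomial

/-! ### Cor 28: the number of connected sets of size `s` -/

section ConnectedSets

variable {V : Type*} [Fintype V] [DecidableEq V] {G : SimpleGraph V} [DecidableRel G.Adj]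

/-- The binomial inequality `C((d-1)s+1, s-1) ≤ s·C((d-1)s, s)` for `d ≥ 3`, `s ≥ 1` (equivalent to
`(d-1)s + 1 ≤ ((d-2)s+1)((d-2)s+2)`; it converts the exploration count per vertex into the per-graph count
of Cor 28 after dividing by `s`). [cite: FawziGrospellierLeverrier2018, Cor 28 proof (§7.2, arXiv v2 p0019)] -/
theorem choose_explore_le_mul_choose {d s : ℕ} (hd : 3 ≤ d) (hs : 1 ≤ s) :
    ((d - 1) * s + 1).choose (s - 1) ≤ s * ((d - 1) * s).choose s := by
  obtain ⟨e, rfl⟩ : ∃ e, d = e + 3 := ⟨d - 3, by omega⟩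
  obtain ⟨k, rfl⟩ : ∃ k, s = k + 1 := ⟨s - 1, by omega⟩
  simp only [Nat.add_sub_cancel, show e + 3 - 1 = e + 2 by omega]
  set N : ℕ := (e + 2) * (k + 1) with hN
  -- `C(N,k)(N+1) = C(N+1,k)(N+1-k)` and `C(N,k+1)(k+1) = C(N,k)(N-k)`
  have h1 := Nat.choose_mul_succ_eq N k
  have h2 := Nat.choose_succ_right_eq N k
  have hkN : k ≤ N := by
    rw [hN]; nlinarith
  have hpos : 0 < N + 1 - k := by omega
  -- the arithmetic core: `N + 1 ≤ (N - k)(N + 1 - k)`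
  have hcore : N + 1 ≤ (N - k) * (N + 1 - k) := by
    have hNk : N - k = (e + 1) * (k + 1) + 1 := by
      rw [hN]; ring_nf; omega
    have hNk' : N + 1 - k = (e + 1) * (k + 1) + 2 := by omega
    rw [hNk, hNk', hN]
    set a : ℕ := (e + 1) * (k + 1) with ha
    have hka : k + 1 ≤ a := by rw [ha]; exact Nat.le_mul_of_pos_left _ (by omega)
    have hsplit : (e + 2) * (k + 1) = a + (k + 1) := by rw [ha]; ring
    have h3 : a + (k + 1) + 1 ≤ 3 * a + 2 := by omega
    have h4 : 3 * a + 2 ≤ (a + 1) * (a + 2) := by nlinarith [Nat.zero_le (a * a)]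
    rw [hsplit]
    exact h3.trans h4
  refine Nat.le_of_mul_le_mul_right ?_ hpos
  calc (N + 1).choose k * (N + 1 - k) = N.choose k * (N + 1) := h1.symm
    _ ≤ N.choose k * ((N - k) * (N + 1 - k)) := Nat.mul_le_mul_left _ hcore
    _ = (N.choose k * (N - k)) * (N + 1 - k) := by ring
    _ = (N.choose (k + 1) * (k + 1)) * (N + 1 - k) := by rw [h2]
    _ = (k + 1) * N.choose (k + 1) * (N + 1 - k) := by ring

/-- **FGL18 Corollary 28 (middle line), PROVED**: in a graph all of whose degrees are `≤ d`, `d ≥ 3`, the number of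
connected vertex sets of cardinality `s ≥ 1` is at most `|V|·C((d-1)s, s)` (double count `Σ_v |𝒞_s(v)| = s|𝒞_s(𝒢)|`,
the exploration bound `|𝒞_s(v)| ≤ C((d-1)s+1, s-1)`, and `C((d-1)s+1, s-1) ≤ s·C((d-1)s, s)`).
[cite: FawziGrospellierLeverrier2018, Lemma 27 / Cor 28 (§7.2, arXiv v2 p0019)] -/
theorem card_connectedOfCard_le_mul_choose {d : ℕ} (hd : 3 ≤ d) (hΔ : ∀ x, G.degree x ≤ d) {s : ℕ}
    (hs : 1 ≤ s) : (connectedOfCard G s).card ≤ Fintype.card V * ((d - 1) * s).choose s := by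
  classical
  set C := connectedOfCard G s with hC
  have hmem : ∀ {S : Finset V}, S ∈ C ↔ S.card = s ∧ IsGraphConnected G S := by
    intro S; simp [hC, connectedOfCard]
  -- double counting: `s·|C| = Σ_v |{S ∈ C : v ∈ S}|`
  have hdc := Finset.sum_card_bipartiteAbove_eq_sum_card_bipartiteBelow
    (s := (Finset.univ : Finset V)) (t := C) (r := fun v S => v ∈ S)
  have hright : ∑ S ∈ C, ((Finset.univ : Finset V).bipartiteBelow (fun v S => v ∈ S) S).card = s * C.card := by
    have : ∀ S ∈ C, ((Finset.univ : Finset V).bipartiteBelow (fun v S => v ∈ S) S).card = s := by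
      intro S hS
      have hfilter : (Finset.univ : Finset V).bipartiteBelow (fun v S => v ∈ S) S = S := by
        ext v; simp [Finset.bipartiteBelow]
      rw [hfilter]; exact (hmem.1 hS).1
    rw [Finset.sum_congr rfl this, Finset.sum_const, smul_eq_mul, mul_comm]
  -- per-vertex exploration bound
  have hleft : ∑ v ∈ (Finset.univ : Finset V), (C.bipartiteAbove (fun v S => v ∈ S) v).card
      ≤ Fintype.card V * ((d - 1) * s + 1).choose (s - 1) := by
    have hv : ∀ v ∈ (Finset.univ : Finset V),
        (C.bipartiteAbove (fun v S => v ∈ S) v).card ≤ ((d - 1) * s + 1).choose (s - 1) := by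
      intro v _
      refine TreeCount.card_le_choose_of_isGraphConnected (G := G) (by omega) hΔ v _ ?_
      intro X hX
      rw [Finset.mem_bipartiteAbove] at hX
      exact ⟨(hmem.1 hX.1).2, (hmem.1 hX.1).1, hX.2⟩
    refine (Finset.sum_le_sum hv).trans ?_
    simp
  have hkey : s * C.card ≤ Fintype.card V * (s * ((d - 1) * s).choose s) := by
    calc s * C.card = _ := hright.symm
      _ = _ := hdc.symm
      _ ≤ Fintype.card V * ((d - 1) * s + 1).choose (s - 1) := hleft
      _ ≤ Fintype.card V * (s * ((d - 1) * s).choose s) :=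
          Nat.mul_le_mul_left _ (choose_explore_le_mul_choose hd hs)
  have hkey' : s * C.card ≤ s * (Fintype.card V * ((d - 1) * s).choose s) := by
    calc s * C.card ≤ Fintype.card V * (s * ((d - 1) * s).choose s) := hkey
      _ = s * (Fintype.card V * ((d - 1) * s).choose s) := by ring
  exact Nat.le_of_mul_le_mul_left hkey' hs

end ConnectedSets

/-! ### The weight of "a fixed `X` is an `α`-subset of `E`" -/

section Dense

variable {V : Type*} [Fintype V] [DecidableEq V]

/-- Sums over a union of events are at most the sum of the sums (nonnegative weights). [folklore] -/
private theorem sum_biUnion_le_sum'' {ι β : Type*} [DecidableEq β] (T : Finset ι) (B : ι → Finset β)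
    (W : β → ℝ) (hW : ∀ b, 0 ≤ W b) : ∑ b ∈ T.biUnion B, W b ≤ ∑ a ∈ T, ∑ b ∈ B a, W b := by
  classical
  induction T using Finset.induction_on with
  | empty => simp
  | insert a T ha ih =>
    rw [Finset.biUnion_insert, Finset.sum_insert ha]
    have hu : ∑ b ∈ B a ∪ T.biUnion B, W b ≤ ∑ b ∈ B a, W b + ∑ b ∈ T.biUnion B, W b := by
      rw [← Finset.sum_union_inter]
      have : 0 ≤ ∑ b ∈ B a ∩ T.biUnion B, W b := sum_nonneg fun b _ => hW b
      linarith
    linarith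

/-- **Weight of "a FIXED set `X` is an `α`-subset of `E`", sharp form**: for a locally stochastic weight of
parameter `0 < p`, `0 < α` with `e^{h(α)/α}p ≤ 1`:
`Σ_{E : α|X| ≤ |X ∩ E|} μ(E) ≤ e^{h(α)|X|} p^{α|X|}` — cover by the subsets `F ⊆ X` of size EXACTLY `⌈α|X|⌉`
(`C(|X|,⌈α|X|⌉)` of them, each of weight `≤ p^{⌈α|X|⌉}`), then Lemma 25 and the monotonicity of `h(x)/x`:
`C(s,m)p^m ≤ (e^{h(α)/α}p)^m ≤ (e^{h(α)/α}p)^{αs}`. (The printed chain sums over all `m ≥ αs` and pays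
`1/(1 - 2^{h(α)/α}p)`; this one does not.)
[cite: FawziGrospellierLeverrier2018, Thm 17 proof (P[|X ∩ E| ≥ α|X|] ≤ …; §4, arXiv v2 p0013 L47-64)] -/
theorem sum_filter_alphaDense_le_exp {μ : Finset V → ℝ} {p : ℝ} (hμ : IsLocallyStochastic μ p)
    (hp0 : 0 < p) {α : ℝ} (hα0 : 0 < α)
    (hbase : Real.exp (Real.binEntropy α / α) * p ≤ 1) (X : Finset V)
    [DecidablePred fun E : Finset V => IsAlphaSubset α E X] :
    ∑ E ∈ univ.filter (fun E => IsAlphaSubset α E X), μ E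
      ≤ Real.exp (Real.binEntropy α * X.card) * p ^ (α * X.card) := by
  classical
  set s : ℕ := X.card with hsdef
  set m : ℕ := ⌈α * s⌉₊ with hmdef
  -- cover by the subsets of `X` of size exactly `m`
  have hcover : univ.filter (fun E => IsAlphaSubset α E X) ⊆
      (X.powersetCard m).biUnion fun F => univ.filter fun E => F ⊆ E := by
    intro E hE
    rw [Finset.mem_filter] at hE
    have hXE : α * X.card ≤ ((X ∩ E).card : ℝ) := hE.2
    have hm_le : m ≤ (X ∩ E).card := by
      rw [hmdef, hsdef]
      exact Nat.ceil_le.2 hXE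
    obtain ⟨F, hFsub, hFcard⟩ := Finset.exists_subset_card_eq hm_le
    rw [Finset.mem_biUnion]
    refine ⟨F, Finset.mem_powersetCard.2 ⟨hFsub.trans Finset.inter_subset_left, hFcard⟩, ?_⟩
    exact Finset.mem_filter.2 ⟨Finset.mem_univ _, hFsub.trans Finset.inter_subset_right⟩
  have hstep1 : ∑ E ∈ univ.filter (fun E => IsAlphaSubset α E X), μ E
      ≤ ((X.powersetCard m).card : ℝ) * p ^ m := by
    refine (Finset.sum_le_sum_of_subset_of_nonneg hcover fun E _ _ => hμ.nonneg E).trans ?_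
    refine (sum_biUnion_le_sum'' _ _ μ hμ.nonneg).trans ?_
    have hF : ∀ F ∈ X.powersetCard m, ∑ E ∈ univ.filter (fun E => F ⊆ E), μ E ≤ p ^ m := by
      intro F hF
      rw [Finset.mem_powersetCard] at hF
      have h := hμ.sum_filter_superset_le F
      rw [hF.2] at h
      exact h
    refine (Finset.sum_le_sum hF).trans ?_
    rw [Finset.sum_const, nsmul_eq_mul]
  rw [Finset.card_powersetCard] at hstep1
  refine hstep1.trans ?_
  -- `C(s,m) p^m ≤ e^{h(α)s} p^{αs}`
  have hpow_m : (p : ℝ) ^ m = p ^ (m : ℝ) := (Real.rpow_natCast p m).symm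
  by_cases hms : m ≤ s
  · rcases Nat.eq_zero_or_pos s with hs0 | hs
    · -- `X = ∅`
      have hm0 : m = 0 := by omega
      rw [hs0] at hms
      simp [hm0, hs0]
    have hs' : (0 : ℝ) < s := by exact_mod_cast hs
    have hαs : α * s ≤ (m : ℝ) := by rw [hmdef]; exact Nat.le_ceil _
    have hm_pos : (0 : ℝ) < m := lt_of_lt_of_le (mul_pos hα0 hs') hαs
    -- Lemma 25 and the slope bound: `C(s,m) ≤ exp(m·h(α)/α)`
    have hx1 : (m : ℝ) / s ≤ 1 := by
      rw [div_le_one hs']; exact_mod_cast hms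
    have hxα : α ≤ (m : ℝ) / s := by
      rw [le_div_iff₀ hs']; exact hαs
    have hslope := binEntropy_div_le_div hα0 hxα hx1
    have hchoose : ((s.choose m : ℕ) : ℝ) ≤ Real.exp (m * (Real.binEntropy α / α)) := by
      refine (choose_le_exp_mul_binEntropy hms).trans ?_
      refine Real.exp_le_exp.2 ?_
      have hxpos : (0 : ℝ) < (m : ℝ) / s := div_pos hm_pos hs'
      have h1 : (s : ℝ) * Real.binEntropy ((m : ℝ) / s) = m * (Real.binEntropy ((m : ℝ) / s) / ((m : ℝ) / s)) := by
        field_simp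
      rw [h1]
      exact mul_le_mul_of_nonneg_left hslope hm_pos.le
    -- `C(s,m) p^m ≤ (e^{h/α} p)^m ≤ (e^{h/α} p)^{αs}`
    set b : ℝ := Real.exp (Real.binEntropy α / α) * p with hbdef
    have hb0 : 0 < b := mul_pos (Real.exp_pos _) hp0
    have h2 : ((s.choose m : ℕ) : ℝ) * p ^ m ≤ b ^ (m : ℝ) := by
      rw [hbdef, Real.mul_rpow (Real.exp_pos _).le hp0.le, ← Real.exp_mul, hpow_m,
        show Real.binEntropy α / α * m = m * (Real.binEntropy α / α) by ring]
      exact mul_le_mul_of_nonneg_right hchoose (Real.rpow_nonneg hp0.le _)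
    have h3 : b ^ (m : ℝ) ≤ b ^ (α * s) := Real.rpow_le_rpow_of_exponent_ge hb0 hbase hαs
    have h4 : b ^ (α * s) = Real.exp (Real.binEntropy α * s) * p ^ (α * s) := by
      rw [hbdef, Real.mul_rpow (Real.exp_pos _).le hp0.le, ← Real.exp_mul]
      congr 2
      field_simp
    calc ((s.choose m : ℕ) : ℝ) * p ^ m ≤ b ^ (m : ℝ) := h2
      _ ≤ b ^ (α * s) := h3
      _ = _ := h4
  · -- `m > s`: no subset of that size
    push Not at hms
    rw [Nat.choose_eq_zero_of_lt hms]
    simp only [Nat.cast_zero, zero_mul]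
    positivity

end Dense

/-! ### Theorem 17 -/

section Theorem17

open Classical in
/-- **Fawzi–Grospellier–Leverrier 2018, Theorem 17 (`α`-percolation, local stochastic case), PROVED as typed —
discharges the named fact `FGL18_theorem17`**: for a graph of degree `≤ d` (`d ≥ 3`), `α ∈ (0,1]`, `t ≥ 1` and a
locally stochastic error of parameter `0 < p < p_ls = (e^{-h(α)}/K(d))^{1/α}`, `K(d) = (d-1)(1+1/(d-2))^{d-2}`:
`P[MaxConn_α(E) ≥ t] ≤ C|V|(p/p_ls)^{αt}`, `1/C = (1 - e^{h(α)/α}p)(1 - (p/p_ls)^α)`. Proof as printed: union bound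
over `s ≥ t` and `X ∈ 𝒞_s(𝒢)` (`|𝒞_s(𝒢)| ≤ |V| K(d)^s`, Cor 28 via the exploration count), the fixed-`X` bound
`e^{h(α)s}p^{αs}`, and the geometric sum in `q = K e^{h(α)} p^α = (p/p_ls)^α < 1`.
[cite: FawziGrospellierLeverrier2018, Thm 17 eqs. (pls), (problc) (§4, arXiv v2 p0013 L7-24) and its proof (p0013 L38-75)] -/
theorem FGL18_theorem17_holds : FGL18_theorem17 := by
  intro V _ _ G _ d hd hdeg α hα0 hα1 t ht p μ hp0 hpls hμ
  classical
  -- the constants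
  set K : ℝ := ((d : ℝ) - 1) * (1 + 1 / ((d : ℝ) - 2)) ^ (d - 2) with hKdef
  set pls : ℝ := percolationValue d α with hplsdef
  have hd' : (3 : ℝ) ≤ d := by exact_mod_cast hd
  have hK1 : 1 ≤ K := by
    rw [hKdef]
    have h1 : (1 : ℝ) ≤ (d : ℝ) - 1 := by linarith
    have h2 : (1 : ℝ) ≤ (1 + 1 / ((d : ℝ) - 2)) ^ (d - 2) :=
      one_le_pow₀ (by have : (0 : ℝ) < (d : ℝ) - 2 := by linarith
                      have := div_pos one_pos this; linarith)
    nlinarith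
  have hK0 : 0 < K := by linarith
  have hh0 : 0 ≤ Real.binEntropy α := Real.binEntropy_nonneg hα0.le hα1
  have hplsα : pls ^ α = Real.exp (-Real.binEntropy α) / K := by
    rw [hplsdef, percolationValue, ← hKdef, one_div, Real.rpow_inv_rpow (by positivity) hα0.ne']
  have hpls0 : 0 < pls := by
    rw [hplsdef, percolationValue, ← hKdef]; positivity
  have hp1 : p ≤ 1 := by
    -- `p < p_ls ≤ 1` since `p_ls^α = e^{-h}/K ≤ 1`
    have hpa : pls ^ α ≤ 1 := by
      rw [hplsα, div_le_one hK0]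
      exact (Real.exp_le_one_iff.2 (by linarith)).trans hK1
    have hpls1 : pls ≤ 1 := by
      by_contra hgt
      push Not at hgt
      have := Real.one_lt_rpow hgt hα0
      linarith
    linarith
  -- `q = (p/p_ls)^α = K e^{h} p^α < 1`
  set q : ℝ := (p / pls) ^ α with hqdef
  have hq0 : 0 ≤ q := Real.rpow_nonneg (div_nonneg hp0.le hpls0.le) α
  have hq1 : q < 1 := by
    rw [hqdef]
    exact Real.rpow_lt_one (div_nonneg hp0.le hpls0.le) ((div_lt_one hpls0).2 hpls) hα0
  have hqeq : q = K * Real.exp (Real.binEntropy α) * p ^ α := by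
    rw [hqdef, Real.div_rpow hp0.le hpls0.le, hplsα, Real.exp_neg]
    field_simp
  -- `e^{h/α} p ≤ 1` (indeed `(e^{h/α}p)^α = e^h p^α = q/K < 1`)
  have hbase : Real.exp (Real.binEntropy α / α) * p ≤ 1 := by
    by_contra hgt
    push Not at hgt
    have h1 : 1 < (Real.exp (Real.binEntropy α / α) * p) ^ α := Real.one_lt_rpow hgt hα0
    have h2 : (Real.exp (Real.binEntropy α / α) * p) ^ α = Real.exp (Real.binEntropy α) * p ^ α := by
      rw [Real.mul_rpow (Real.exp_pos _).le hp0.le, ← Real.exp_mul, div_mul_cancel₀ _ hα0.ne']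
    have h3 : Real.exp (Real.binEntropy α) * p ^ α ≤ q := by
      rw [hqeq]
      have : 0 ≤ Real.exp (Real.binEntropy α) * p ^ α := by positivity
      nlinarith
    linarith
  -- the union bound over sizes `s ∈ [t, |V|]` and clusters `X ∈ 𝒞_s`
  set clusters : Finset (Finset V) :=
    (Finset.Icc t (Fintype.card V)).biUnion fun s => connectedOfCard G s with hclusters
  have hmem : ∀ {s : ℕ} {S : Finset V}, S ∈ connectedOfCard G s ↔ S.card = s ∧ IsGraphConnected G S := by
    intro s S; simp [connectedOfCard]
  have hcover : univ.filter (fun E => HasAlphaCluster G α t E) ⊆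
      clusters.biUnion fun X => univ.filter fun E => IsAlphaSubset α E X := by
    intro E hE
    rw [Finset.mem_filter] at hE
    obtain ⟨X, hXconn, htX, hXE⟩ := hE.2
    rw [Finset.mem_biUnion]
    refine ⟨X, ?_, Finset.mem_filter.2 ⟨Finset.mem_univ _, hXE⟩⟩
    rw [hclusters, Finset.mem_biUnion]
    exact ⟨X.card, Finset.mem_Icc.2 ⟨htX, Finset.card_le_univ X⟩, hmem.2 ⟨rfl, hXconn⟩⟩
  have h1 : ∑ E ∈ univ.filter (fun E => HasAlphaCluster G α t E), μ E ≤
      ∑ X ∈ clusters, ∑ E ∈ univ.filter (fun E => IsAlphaSubset α E X), μ E :=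
    (Finset.sum_le_sum_of_subset_of_nonneg hcover fun E _ _ => hμ.nonneg E).trans
      (sum_biUnion_le_sum'' clusters _ μ hμ.nonneg)
  set r : ℝ := Real.exp (Real.binEntropy α) * p ^ α with hrdef
  have hr0 : 0 ≤ r := by positivity
  have h2 : ∑ X ∈ clusters, ∑ E ∈ univ.filter (fun E => IsAlphaSubset α E X), μ E ≤
      ∑ X ∈ clusters, r ^ X.card := by
    refine Finset.sum_le_sum fun X _ => ?_
    refine (sum_filter_alphaDense_le_exp hμ hp0 hα0 hbase X).trans (le_of_eq ?_)
    rw [hrdef, mul_pow, ← Real.exp_nat_mul, ← Real.rpow_natCast (p ^ α), ← Real.rpow_mul hp0.le]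
    ring_nf
  have h3 : ∑ X ∈ clusters, r ^ X.card ≤
      ∑ s ∈ Finset.Icc t (Fintype.card V), ∑ X ∈ connectedOfCard G s, r ^ X.card := by
    rw [hclusters]
    exact sum_biUnion_le_sum'' _ _ _ fun X => pow_nonneg hr0 _
  have h4 : ∀ s ∈ Finset.Icc t (Fintype.card V),
      ∑ X ∈ connectedOfCard G s, r ^ X.card ≤ (Fintype.card V : ℝ) * q ^ s := by
    intro s hs
    have hs1 : 1 ≤ s := ht.trans (Finset.mem_Icc.1 hs).1
    have hconst : ∑ X ∈ connectedOfCard G s, r ^ X.card = ((connectedOfCard G s).card : ℝ) * r ^ s := by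
      rw [Finset.sum_congr rfl fun X hX => by rw [(hmem.1 hX).1], Finset.sum_const, nsmul_eq_mul]
    rw [hconst]
    have hcount : ((connectedOfCard G s).card : ℝ) ≤ (Fintype.card V : ℝ) * K ^ s := by
      have h := card_connectedOfCard_le_mul_choose (G := G) hd hdeg hs1
      have h' : ((connectedOfCard G s).card : ℝ) ≤ (Fintype.card V : ℝ) * ((((d - 1) * s).choose s : ℕ) : ℝ) := by
        exact_mod_cast h
      refine h'.trans ?_
      exact mul_le_mul_of_nonneg_left (by rw [hKdef]; exact choose_le_K_pow hd s) (Nat.cast_nonneg _)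
    calc ((connectedOfCard G s).card : ℝ) * r ^ s ≤ (Fintype.card V : ℝ) * K ^ s * r ^ s :=
          mul_le_mul_of_nonneg_right hcount (pow_nonneg hr0 _)
      _ = (Fintype.card V : ℝ) * q ^ s := by rw [hqeq, hrdef]; ring
  have h5 : ∑ s ∈ Finset.Icc t (Fintype.card V), (Fintype.card V : ℝ) * q ^ s ≤
      (Fintype.card V : ℝ) * (q ^ t / (1 - q)) := by
    rw [← Finset.mul_sum]
    refine mul_le_mul_of_nonneg_left ?_ (Nat.cast_nonneg _)
    have hIcc : Finset.Icc t (Fintype.card V) = Finset.Ico t (Fintype.card V + 1) := by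
      ext s; simp only [Finset.mem_Icc, Finset.mem_Ico]; omega
    rw [hIcc]
    exact geom_sum_Ico_le_of_lt_one hq0 hq1
  -- the printed constant: `1/((1 - e^{h/α}p)(1 - q)) ≥ 1/(1-q)`
  have hqt : q ^ t = (p / pls) ^ (α * t) := by
    rw [hqdef, ← Real.rpow_natCast, ← Real.rpow_mul (div_nonneg hp0.le hpls0.le)]
  have hb1 : 0 < 1 - Real.exp (Real.binEntropy α / α) * p ∧ 1 - Real.exp (Real.binEntropy α / α) * p ≤ 1 := by
    constructor
    · -- strict: `(e^{h/α}p)^α = e^h p^α ≤ q < 1` hence `e^{h/α} p < 1`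
      have h2 : (Real.exp (Real.binEntropy α / α) * p) ^ α = Real.exp (Real.binEntropy α) * p ^ α := by
        rw [Real.mul_rpow (Real.exp_pos _).le hp0.le, ← Real.exp_mul, div_mul_cancel₀ _ hα0.ne']
      have h3 : Real.exp (Real.binEntropy α) * p ^ α ≤ q := by
        rw [hqeq]
        have : 0 ≤ Real.exp (Real.binEntropy α) * p ^ α := by positivity
        nlinarith
      have hlt : Real.exp (Real.binEntropy α / α) * p < 1 := by
        by_contra hge
        push Not at hge
        have := Real.one_le_rpow hge hα0.le
        linarith
      linarith
    · have : 0 ≤ Real.exp (Real.binEntropy α / α) * p := by positivity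
      linarith
  have hfinal : (Fintype.card V : ℝ) * (q ^ t / (1 - q)) ≤
      1 / ((1 - Real.exp (Real.binEntropy α / α) * p) * (1 - (p / pls) ^ α)) *
        Fintype.card V * (p / pls) ^ (α * t) := by
    rw [← hqdef, hqt]
    have h1q : 0 < 1 - q := by linarith
    have hxt : 0 ≤ (p / pls) ^ (α * t) := Real.rpow_nonneg (div_nonneg hp0.le hpls0.le) _
    have hn : (0 : ℝ) ≤ Fintype.card V := Nat.cast_nonneg _
    rw [show (Fintype.card V : ℝ) * ((p / pls) ^ (α * t) / (1 - q))
        = 1 / (1 - q) * Fintype.card V * (p / pls) ^ (α * t) by ring]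
    refine mul_le_mul_of_nonneg_right (mul_le_mul_of_nonneg_right ?_ hn) hxt
    rw [div_le_div_iff₀ h1q (mul_pos hb1.1 h1q)]
    nlinarith [hb1.1, hb1.2, h1q]
  calc ∑ E ∈ univ.filter (fun E => HasAlphaCluster G α t E), μ E
      ≤ ∑ X ∈ clusters, ∑ E ∈ univ.filter (fun E => IsAlphaSubset α E X), μ E := h1
    _ ≤ ∑ X ∈ clusters, r ^ X.card := h2
    _ ≤ ∑ s ∈ Finset.Icc t (Fintype.card V), ∑ X ∈ connectedOfCard G s, r ^ X.card := h3
    _ ≤ ∑ s ∈ Finset.Icc t (Fintype.card V), (Fintype.card V : ℝ) * q ^ s := Finset.sum_le_sum h4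
    _ ≤ (Fintype.card V : ℝ) * (q ^ t / (1 - q)) := h5
    _ ≤ _ := hfinal

end Theorem17

end Literature.InformationTheory.QuantumCodes
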